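import Mathlib
import Summits.Schanuel.Schanuel.Theorems.RigidCoreMinimalCounterexampleInAclNoFullLineSlice
import Literature.RingTheory.NoetherNormalization.GenericLinearForms

/-!
# The monomial slice variety — crux stmt-Schanuel-0969 `RigidCore.MinimalCounterexampleInAcl`

Line `kernel-arithmetic-selection`, `--supports stmt-Schanuel-0969`; the registered stub
`stub_monomialSliceVariety` (R2α), pure algebra feeding the dimension drop R2β
(`stub_lineVariety_deadDirections`) in the reduction of S7b (no full line of mates at corank `≥ 2`) to free
coset-line sparsity.

Setting: a family of points `P_j = (z(j), y(j)) ∈ ℂⁿ × (ℂˣ)ⁿ`, `j ∈ J ⊆ ℤ`, such that every `ℚ`-polynomial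
relation of `P_{j₀}` holds at every `P_j`, and `s` integer directions `M_t ∈ ℤⁿ` are DEAD along the family:
the additive values `b_t = M_t · z(j)` and the Laurent monomials `β_t = y(j)^{M_t} = ∏ᵢ yᵢ(j)^{M_t i}` do not depend
on `j`.  Then the `ℚ(b, β)`-locus `W` of `P_{j₀}` (`kLocus`, Theorems/…NoFullLineSlice) is Zariski closed, contains
every `P_j`, and has `zariskiDim ℂ W ≤ #T` as soon as every coordinate of `P_{j₀}` is algebraic over `ℚ[b, β, T]`
(`T ⊆ ℂ` finite).

* `zariskiDim_kLocus_le_card` — `dim kLocus[K, P] ≤ #T` if the coordinates of `P` are algebraic over `K[T]`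
  (`zariskiDim_kLocus_le` + `Literature.RingTheory.NoetherNormalization.trdeg_adjoin_le_of_forall_isAlgebraic`);
* `exists_num_of_common_denom`, `relations_transfer_of_common_denom` — clearing a COMMON DENOMINATOR: if the constants
  `e_k` are fractions `num_k(P_j) / D(P_j)` with numerators and denominator NOT depending on `j`, every
  `ℚ`-relation of `(e, P_{j₀})` transfers to `(e, P_j)`;
* `laurent_relations_transfer` — the instance `e = (b, β)`, `D = ∏_t ∏_i Y_i^{(M t i)⁻}` (Laurent denominators);
* `monomialSliceVariety` / `stub_monomialSliceVariety` — the slice variety.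

References: H. Matsumura, *Commutative Ring Theory*, CUP 1986, Thm 5.6 (dimension of an affine domain is its
transcendence degree).
-/

noncomputable section

set_option linter.dupNamespace false

open Complex Set MvPolynomial

namespace Summit.Schanuel.Schanuel.Cruxes.MinimalCounterexampleInAcl.KernelArithmeticSelection

open Literature.NumberTheory.Transcendental (IsZariskiClosed zariskiDim)

/-- The `K`-locus `kLocus[K, P]` of a point `P ∈ ℂ^σ` (local notation, as in Theorems/…NoFullLineSlice): the common
zeros in `ℂ^σ` of the `K`-polynomial relations of `P`. -/
local notation3 "kLocus[" K ", " P "]" =>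
  MvPolynomial.zeroLocus ℂ (RingHom.ker (MvPolynomial.aeval (R := K) (S₁ := ℂ) P))

/-! ## Dimension of the `K`-locus over a finite set of parameters -/

section KLocus

variable {σ : Type} [Fintype σ] {K : Type} [Field K] [Algebra K ℂ] {P : σ → ℂ}

/-- **The `K`-locus of a point algebraic over `K[T]` has dimension `≤ #T`**: if every coordinate of `P` is algebraic
over `K[T]` for a finite `T ⊆ ℂ`, then `zariskiDim ℂ (kLocus[K, P]) ≤ #T` (`zariskiDim_kLocus_le`: the dimension is at
most `trdeg_K K[P] ≤ #T`). [cite: Matsumura1987, Thm 5.6] -/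
theorem zariskiDim_kLocus_le_card (T : Finset ℂ)
    (halg : ∀ i, IsAlgebraic (Algebra.adjoin K (↑T : Set ℂ)) (P i)) :
    zariskiDim ℂ (kLocus[K, P]) ≤ ((T.card : ℕ) : WithBot ℕ∞) := by
  refine (zariskiDim_kLocus_le (K := K) (P := P)).trans ?_
  have h : Algebra.trdeg K (Algebra.adjoin K (Set.range P)) ≤ Cardinal.mk (↑T : Set ℂ) :=
    Literature.RingTheory.NoetherNormalization.trdeg_adjoin_le_of_forall_isAlgebraic (by
      rintro _ ⟨i, rfl⟩; exact halg i)
  have hT : Cardinal.mk (↑T : Set ℂ) = (T.card : Cardinal) := by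
    simp only [Finset.coe_sort_coe, Cardinal.mk_coe_finset]
  rw [hT] at h
  have h2 : Cardinal.toNat (Algebra.trdeg K (Algebra.adjoin K (Set.range P))) ≤ T.card := by
    have := Cardinal.toNat_le_toNat h (Cardinal.natCast_lt_aleph0 (n := T.card))
    simpa only [Cardinal.toNat_natCast] using this
  exact_mod_cast h2

end KLocus

/-! ## Clearing a common denominator -/

section Clearing

variable {ι σ κ : Type}

/-- **Clearing a common denominator.**  If the constants `e_k` satisfy `e_k · D(P_j) = num_k(P_j)` for all `j ∈ J`
with `ℚ`-polynomials `D`, `num_k` NOT depending on `j`, then for every `H ∈ ℚ[E, X]` there are `G ∈ ℚ[X]` and `N`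
with `H(e, P_j) · D(P_j)^N = G(P_j)` for all `j ∈ J`. [folklore] -/
theorem exists_num_of_common_denom (ev : ι → ℂ) (J : Set κ) (P : κ → σ → ℂ)
    (D : MvPolynomial σ ℚ) (num : ι → MvPolynomial σ ℚ)
    (hnum : ∀ k, ∀ j ∈ J, ev k * MvPolynomial.aeval (P j) D = MvPolynomial.aeval (P j) (num k))
    (H : MvPolynomial (ι ⊕ σ) ℚ) :
    ∃ (G : MvPolynomial σ ℚ) (N : ℕ), ∀ j ∈ J,
      MvPolynomial.aeval (Sum.elim ev (P j)) H * (MvPolynomial.aeval (P j) D) ^ N =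
        MvPolynomial.aeval (P j) G := by
  classical
  induction H using MvPolynomial.induction_on with
  | C a =>
    exact ⟨MvPolynomial.C a, 0, fun j _ => by simp only [MvPolynomial.algHom_C, pow_zero, mul_one]⟩
  | add p q hp hq =>
    obtain ⟨G₁, N₁, h₁⟩ := hp
    obtain ⟨G₂, N₂, h₂⟩ := hq
    refine ⟨G₁ * D ^ N₂ + G₂ * D ^ N₁, N₁ + N₂, fun j hj => ?_⟩
    simp only [map_add, map_mul, map_pow]
    rw [← h₁ j hj, ← h₂ j hj]
    ring
  | mul_X p k hp =>
    obtain ⟨G, N, h⟩ := hp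
    cases k with
    | inl k =>
      refine ⟨G * num k, N + 1, fun j hj => ?_⟩
      simp only [map_mul, MvPolynomial.aeval_X, Sum.elim_inl]
      rw [← h j hj, ← hnum k j hj]
      ring
    | inr w =>
      refine ⟨G * MvPolynomial.X w, N, fun j hj => ?_⟩
      simp only [map_mul, MvPolynomial.aeval_X, Sum.elim_inr]
      rw [← h j hj]
      ring

/-- **Transfer of relations by a common denominator.**  In the situation of `exists_num_of_common_denom`, if moreover
`D(P_j) ≠ 0` on `J` and every `ℚ`-relation of `P_{j₀}` (`j₀ ∈ J`) holds at every `P_j`, then every `ℚ`-relation of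
`(e, P_{j₀})` holds at every `(e, P_j)`, `j ∈ J`. [folklore] -/
theorem relations_transfer_of_common_denom (ev : ι → ℂ) (J : Set κ) (P : κ → σ → ℂ)
    (D : MvPolynomial σ ℚ) (num : ι → MvPolynomial σ ℚ)
    (hnum : ∀ k, ∀ j ∈ J, ev k * MvPolynomial.aeval (P j) D = MvPolynomial.aeval (P j) (num k))
    (hD : ∀ j ∈ J, MvPolynomial.aeval (P j) D ≠ 0) {j₀ : κ} (hj₀ : j₀ ∈ J)
    (hrel : ∀ j ∈ J, ∀ G : MvPolynomial σ ℚ, MvPolynomial.aeval (P j₀) G = 0 →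
      MvPolynomial.aeval (P j) G = 0)
    {j : κ} (hj : j ∈ J) (H : MvPolynomial (ι ⊕ σ) ℚ)
    (hH : MvPolynomial.aeval (Sum.elim ev (P j₀)) H = 0) :
    MvPolynomial.aeval (Sum.elim ev (P j)) H = 0 := by
  obtain ⟨G, N, h⟩ := exists_num_of_common_denom ev J P D num hnum H
  have h0 : MvPolynomial.aeval (P j₀) G = 0 := by rw [← h j₀ hj₀, hH, zero_mul]
  have h1 := h j hj
  rw [hrel j hj G h0] at h1
  exact (mul_eq_zero.1 h1).resolve_right (pow_ne_zero _ (hD j hj))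

end Clearing

/-! ## Laurent denominators -/

section Laurent

variable {n s : ℕ}

/-- `y^m · y^{m⁻} = y^{m⁺}` for `y ≠ 0` (`m = m⁺ − m⁻`). [folklore] -/
theorem zpow_mul_pow_toNat_neg {y : ℂ} (hy : y ≠ 0) (m : ℤ) :
    y ^ m * y ^ (-m).toNat = y ^ m.toNat := by
  rw [← zpow_natCast, ← zpow_add₀ hy, ← zpow_natCast]
  congr 1
  have := Int.toNat_sub_toNat_neg m
  omega

/-- Laurent clearing for one monomial: `y^{m} · ∏ᵢ yᵢ^{(m i)⁻} = ∏ᵢ yᵢ^{(m i)⁺}` on `(ℂˣ)ⁿ`. [folklore] -/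
theorem prod_zpow_mul_prod_pow_toNat_neg (m : Fin n → ℤ) (y : Fin n → ℂ) (hy : ∀ i, y i ≠ 0) :
    (∏ i, y i ^ m i) * ∏ i, y i ^ (-(m i)).toNat = ∏ i, y i ^ (m i).toNat := by
  rw [← Finset.prod_mul_distrib]
  exact Finset.prod_congr rfl fun i _ => zpow_mul_pow_toNat_neg (hy i) (m i)

/-- Evaluation of the integer linear form `∑ᵢ (m i) X_{inl i}`. [folklore] -/
theorem aeval_sum_C_mul_X_inl (m : Fin n → ℤ) (y : Fin n ⊕ Fin n → ℂ) :
    MvPolynomial.aeval y (∑ i, MvPolynomial.C ((m i : ℤ) : ℚ) * MvPolynomial.X (Sum.inl i)) =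
      ∑ i, (m i : ℂ) * y (Sum.inl i) := by
  simp only [map_sum, map_mul, MvPolynomial.aeval_X, map_intCast]

/-- Evaluation of the Laurent numerator: `y^{m} · (D_m · E)(y) = (Y^{m⁺} · E)(y)` where `D_m = ∏ᵢ Y_i^{(m i)⁻}`.
[folklore] -/
theorem prod_zpow_mul_aeval_denom_mul (m : Fin n → ℤ) (y : Fin n ⊕ Fin n → ℂ) (hy : ∀ i, y (Sum.inr i) ≠ 0)
    (E : MvPolynomial (Fin n ⊕ Fin n) ℚ) :
    (∏ i, y (Sum.inr i) ^ m i) *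
        MvPolynomial.aeval y ((∏ i, MvPolynomial.X (Sum.inr i) ^ (-(m i)).toNat) * E) =
      MvPolynomial.aeval y ((∏ i, MvPolynomial.X (Sum.inr i) ^ (m i).toNat) * E) := by
  simp only [map_mul, map_prod, map_pow, MvPolynomial.aeval_X]
  rw [← mul_assoc, prod_zpow_mul_prod_pow_toNat_neg m (fun i => y (Sum.inr i)) hy]

/-- **LAURENT TRANSFER.**  For a family `P_j = (z(j), y(j)) ∈ ℂⁿ × (ℂˣ)ⁿ` (`j ∈ J`) sharing the `ℚ`-relations of
`P_{j₀}` and the values of the dead additive forms `b_t = M_t · z` and dead Laurent monomials `β_t = y^{M_t}`, every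
`ℚ`-relation of `((b, β), P_{j₀})` holds at `((b, β), P_j)`: clear the common Laurent denominator
`∏_t ∏_i Y_i^{(M t i)⁻}` (`relations_transfer_of_common_denom`). [folklore] -/
theorem laurent_relations_transfer (M : Fin s → Fin n → ℤ) (J : Set ℤ) (P : ℤ → Fin n ⊕ Fin n → ℂ) (j₀ : ℤ)
    (hj₀ : j₀ ∈ J) (hnz : ∀ j ∈ J, ∀ i : Fin n, P j (Sum.inr i) ≠ 0)
    (hrel : ∀ j ∈ J, ∀ G : MvPolynomial (Fin n ⊕ Fin n) ℚ, MvPolynomial.aeval (P j₀) G = 0 →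
      MvPolynomial.aeval (P j) G = 0)
    (hadd : ∀ t : Fin s, ∀ j ∈ J, (∑ i, (M t i : ℂ) * P j (Sum.inl i)) = ∑ i, (M t i : ℂ) * P j₀ (Sum.inl i))
    (hmul : ∀ t : Fin s, ∀ j ∈ J,
      (∏ i, P j (Sum.inr i) ^ (M t i : ℤ)) = ∏ i, P j₀ (Sum.inr i) ^ (M t i : ℤ))
    {j : ℤ} (hj : j ∈ J) (H : MvPolynomial ((Fin s ⊕ Fin s) ⊕ (Fin n ⊕ Fin n)) ℚ)
    (hH : MvPolynomial.aeval (Sum.elim (Sum.elim (fun t => ∑ i, (M t i : ℂ) * P j₀ (Sum.inl i))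
      (fun t => ∏ i, P j₀ (Sum.inr i) ^ (M t i : ℤ))) (P j₀)) H = 0) :
    MvPolynomial.aeval (Sum.elim (Sum.elim (fun t => ∑ i, (M t i : ℂ) * P j₀ (Sum.inl i))
      (fun t => ∏ i, P j₀ (Sum.inr i) ^ (M t i : ℤ))) (P j)) H = 0 := by
  classical
  -- partial Laurent denominators `D_t = ∏_i Y_i^{(M t i)⁻}`, common denominator `D = ∏_t D_t`
  let Dt : Fin s → MvPolynomial (Fin n ⊕ Fin n) ℚ :=
    fun t => ∏ i, MvPolynomial.X (Sum.inr i) ^ (-(M t i)).toNat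
  let D : MvPolynomial (Fin n ⊕ Fin n) ℚ := ∏ t, Dt t
  -- numerators: `b_t · D = (∑ M t i X_{inl i}) · D`, `β_t · D = Y^{M_t⁺} · ∏_{t' ≠ t} D_{t'}`
  let num : Fin s ⊕ Fin s → MvPolynomial (Fin n ⊕ Fin n) ℚ := Sum.elim
    (fun t => (∑ i, MvPolynomial.C ((M t i : ℤ) : ℚ) * MvPolynomial.X (Sum.inl i)) * D)
    (fun t => (∏ i, MvPolynomial.X (Sum.inr i) ^ (M t i).toNat) * ∏ t' ∈ Finset.univ.erase t, Dt t')
  have hD : ∀ t, D = Dt t * ∏ t' ∈ Finset.univ.erase t, Dt t' := fun t =>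
    (Finset.mul_prod_erase Finset.univ Dt (Finset.mem_univ t)).symm
  have hDne : ∀ j ∈ J, MvPolynomial.aeval (P j) D ≠ 0 := by
    intro j hj
    simp only [D, Dt, map_prod, map_pow, MvPolynomial.aeval_X]
    exact Finset.prod_ne_zero_iff.2 fun t _ =>
      Finset.prod_ne_zero_iff.2 fun i _ => pow_ne_zero _ (hnz j hj i)
  refine relations_transfer_of_common_denom _ J P D num ?_ hDne hj₀ hrel hj H hH
  rintro (t | t) j hj
  · -- additive constant `b_t`
    simp only [Sum.elim_inl, num]
    rw [map_mul, aeval_sum_C_mul_X_inl, hadd t j hj]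
  · -- multiplicative constant `β_t`
    simp only [Sum.elim_inr, num]
    rw [← hmul t j hj, hD t]
    exact prod_zpow_mul_aeval_denom_mul (M t) (P j) (hnz j hj) _

end Laurent

/-! ## Base change of algebraicity -/

/-- **Base change of algebraicity**: an element algebraic over `ℚ[e, T]` is algebraic over `ℚ(e)[T]`. [folklore] -/
theorem isAlgebraic_adjoin_adjoin_of_isAlgebraic_adjoin_union {ι : Type} (ev : ι → ℂ) {T : Set ℂ} {z : ℂ}
    (h : IsAlgebraic (Algebra.adjoin ℚ (Set.range ev ∪ T)) z) :
    IsAlgebraic (Algebra.adjoin (IntermediateField.adjoin ℚ (Set.range ev)) T) z := by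
  refine h.tower_top_of_subalgebra_le
    (B := (Algebra.adjoin (IntermediateField.adjoin ℚ (Set.range ev)) T).restrictScalars ℚ) ?_
  refine Algebra.adjoin_le ?_
  rintro y (⟨i, rfl⟩ | hy)
  · have hmem : ev i ∈ IntermediateField.adjoin ℚ (Set.range ev) :=
      IntermediateField.subset_adjoin ℚ _ ⟨i, rfl⟩
    have h1 := Subalgebra.algebraMap_mem
      (Algebra.adjoin (IntermediateField.adjoin ℚ (Set.range ev)) T)
      (⟨ev i, hmem⟩ : IntermediateField.adjoin ℚ (Set.range ev))
    rw [Subalgebra.coe_restrictScalars, SetLike.mem_coe]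
    exact h1
  · rw [Subalgebra.coe_restrictScalars, SetLike.mem_coe]
    exact Algebra.subset_adjoin hy

/-! ## The monomial slice variety -/

/-- **THE MONOMIAL SLICE VARIETY (R2α).**  For a family `P_j ∈ ℂⁿ × (ℂˣ)ⁿ` (`j ∈ J`, `j₀ ∈ J`) sharing the
`ℚ`-relations of `P_{j₀}` and the values `b_t`, `β_t` of `s` dead integer directions (additive forms `M_t · z`,
Laurent monomials `y^{M_t}`), the `ℚ(b, β)`-locus `W` of `P_{j₀}` is Zariski closed, has `zariskiDim ℂ W ≤ #T`
whenever every coordinate of `P_{j₀}` is algebraic over `ℚ[b, β, T]`, and contains every `P_j`.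
[cite: Matsumura1987, Thm 5.6] -/
theorem monomialSliceVariety {n s : ℕ} (M : Fin s → Fin n → ℤ) (J : Set ℤ) (P : ℤ → Fin n ⊕ Fin n → ℂ)
    (j₀ : ℤ) (hj₀ : j₀ ∈ J) (hnz : ∀ j ∈ J, ∀ i : Fin n, P j (Sum.inr i) ≠ 0)
    (hrel : ∀ j ∈ J, ∀ G : MvPolynomial (Fin n ⊕ Fin n) ℚ, MvPolynomial.aeval (P j₀) G = 0 →
      MvPolynomial.aeval (P j) G = 0)
    (hadd : ∀ t : Fin s, ∀ j ∈ J, (∑ i, (M t i : ℂ) * P j (Sum.inl i)) = ∑ i, (M t i : ℂ) * P j₀ (Sum.inl i))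
    (hmul : ∀ t : Fin s, ∀ j ∈ J,
      (∏ i, P j (Sum.inr i) ^ (M t i : ℤ)) = ∏ i, P j₀ (Sum.inr i) ^ (M t i : ℤ))
    (T : Finset ℂ)
    (halg : ∀ v : Fin n ⊕ Fin n, IsAlgebraic
      ↥(Algebra.adjoin ℚ (Set.range (fun t : Fin s => ∑ i, (M t i : ℂ) * P j₀ (Sum.inl i)) ∪
        Set.range (fun t : Fin s => ∏ i, P j₀ (Sum.inr i) ^ (M t i : ℤ)) ∪ (↑T : Set ℂ))) (P j₀ v)) :
    ∃ W : Set (Fin n ⊕ Fin n → ℂ), IsZariskiClosed ℂ W ∧ zariskiDim ℂ W ≤ ((T.card : ℕ) : WithBot ℕ∞) ∧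
      ∀ j ∈ J, P j ∈ W := by
  -- the dead constants `ev = (b, β)`
  let ev : Fin s ⊕ Fin s → ℂ := Sum.elim (fun t : Fin s => ∑ i, (M t i : ℂ) * P j₀ (Sum.inl i))
    (fun t : Fin s => ∏ i, P j₀ (Sum.inr i) ^ (M t i : ℤ))
  have hev : Set.range ev = Set.range (fun t : Fin s => ∑ i, (M t i : ℂ) * P j₀ (Sum.inl i)) ∪
      Set.range (fun t : Fin s => ∏ i, P j₀ (Sum.inr i) ^ (M t i : ℤ)) :=
    Set.Sum.elim_range _ _
  refine ⟨kLocus[IntermediateField.adjoin ℚ (Set.range ev), P j₀], isZariskiClosed_kLocus,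
    zariskiDim_kLocus_le_card T fun v => isAlgebraic_adjoin_adjoin_of_isAlgebraic_adjoin_union ev ?_,
    fun j hj => mem_kLocus_adjoin_of_relations ev fun H hH =>
      laurent_relations_transfer M J P j₀ hj₀ hnz hrel hadd hmul hj H hH⟩
  rw [hev]
  exact halg v

/-- **Registered stub `stub_monomialSliceVariety` (R2α, PROVED)** — uncurried form of `monomialSliceVariety`: the
`ℚ(b, β)`-locus of `P_{j₀}` is a Zariski closed set of dimension `≤ #T` containing every `P_j`.
[cite: Matsumura1987, Thm 5.6] -/
theorem stub_monomialSliceVariety : ∀ (n s : ℕ) (M : Fin s → Fin n → ℤ) (J : Set ℤ) (P : ℤ → Fin n ⊕ Fin n → ℂ) (j₀ : ℤ), j₀ ∈ J → (∀ j ∈ J, ∀ i : Fin n, P j (Sum.inr i) ≠ 0) → (∀ j ∈ J, ∀ G : MvPolynomial (Fin n ⊕ Fin n) ℚ, MvPolynomial.aeval (P j₀) G = 0 → MvPolynomial.aeval (P j) G = 0) → (∀ t : Fin s, ∀ j ∈ J, (∑ i, (M t i : ℂ) * P j (Sum.inl i)) = ∑ i, (M t i : ℂ) * P j₀ (Sum.inl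 i)) → (∀ t : Fin s, ∀ j ∈ J, (∏ i, P j (Sum.inr i) ^ (M t i : ℤ)) = ∏ i, P j₀ (Sum.inr i) ^ (M t i : ℤ)) → ∀ T : Finset ℂ, (∀ v : Fin n ⊕ Fin n, IsAlgebraic ↥(Algebra.adjoin ℚ (Set.range (fun t : Fin s => ∑ i, (M t i : ℂ) * P j₀ (Sum.inl i)) ∪ Set.range (fun t : Fin s => ∏ i, P j₀ (Sum.inr i) ^ (M t i : ℤ)) ∪ (↑T : Set ℂ))) (P j₀ v)) → ∃ W : Set (Fin n ⊕ Fin n → ℂ), Literature.NumberTheory.Transcendental.IsZariskiClosed ℂ W ∧ Literature.NumberTheory.Transcendental.zariskiDim ℂ W ≤ ((T.card : ℕ) : WithBot ℕ∞) ∧ ∀ j ∈ J, P j ∈ W :=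
  fun _ _ M J P j₀ hj₀ hnz hrel hadd hmul T halg => monomialSliceVariety M J P j₀ hj₀ hnz hrel hadd hmul T halg

end Summit.Schanuel.Schanuel.Cruxes.MinimalCounterexampleInAcl.KernelArithmeticSelection

end
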